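import Literature.MathematicalPhysics.QuantumLattice.NarrowWellPlaquetteAction
import Literature.MathematicalPhysics.QuantumLattice.SU2HaarSmallBallUpper
import Literature.MathematicalPhysics.QuantumFieldTheory.TorusClassDirectionKPLog
import Literature.MathematicalPhysics.QuantumFieldTheory.LatticeGaugeUniformTorusAreaLawProofs
import Literature.Probability.LatticeModels.ForbiddenGapFirstOrder
import Literature.Probability.Entropy.DonskerVaradhanTransfer
import HarnessLib

/-!
# Torus pressure of a bounded plaquette weight: slope bounds, and the reduction of the
# van Enter–Shlosman first-order transition to a forbidden-band estimate

Second layer under the named fact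
`Literature.MathematicalPhysics.QuantumLattice.enterShlosman_narrowWell_firstOrderTransition`
(van Enter–Shlosman 2005, Thm. 2, `SU(2)` instance): the MODEL-SPECIFIC but contour-free inputs of
the thermodynamic criterion `ForbiddenGap.exists_not_differentiableAt_of_forbidden_band`
(`Literature/Probability/LatticeModels/ForbiddenGapFirstOrder.lean`), for the pure plaquette theory
with Gibbs factor `exp (J Σ_q w(U_q))` of a continuous weight `0 ≤ w ≤ 1` on a compact group `G`
on the discrete tori `(ℤ/Lℤ)^d` (product Haar a-priori measure):

* (`plaquetteEnergy`, `prod_exp_mul_eq_exp_energy`, `torusPressure_eq`) the torus partition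
  function of the fact is the moment generating function of the plaquette energy
  `H_L = Σ_q w(U_q) ∈ [0, #plaquettes]`, `#plaquettes = #planes · L^d`;
* (`integral_prod_le_pow`, `cgf_plaquetteEnergy_le`) the **disordered (high-temperature) bound**
  `log Z_L(J) ≤ #plaquettes · K⁻¹ · log ∫_G e^{K J w} dg`, `K = 3^d d²`, by the colour–Hölder
  inequality of the torus plaquette hypergraph (`integral_prod_le_prod_rpow`: same-coloured
  plaquettes are bond-disjoint, hence independent with Haar-distributed holonomy);
* (`le_cgf_plaquetteEnergy`) the **ordered (low-temperature) bound**
  `log Z_L(J) ≥ #edges · log Haar(B) + J (1 - c) #plaquettes` for any measurable `B ⊆ G` such that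
  a configuration with all bond variables in `B` has all plaquette weights `≥ 1 - c`
  (restriction of the integral to `B^{edges}`), `#edges = d · L^d`;
* (`integral_weight_le`, `tendsto_integral_weight`) for the narrow well `w = NarrowWell.weight p`
  on `SU(2)`: `∫ w_p dHaar ≤ 4 r³ + (1 - r²/4)^p → 0` (`p → ∞`), from the small-ball bound
  `haarProbability_su2_two_sub_trace_lt_le`; and (`exists_nhds_weight_ge`) a neighbourhood `B` of
  `1` with `w_p(g₁ g₂ g₃⁻¹ g₄⁻¹) ≥ 1 - c` on `B⁴`, of positive Haar measure;
* (**`enterShlosman_narrowWell_firstOrderTransition_of_forbiddenBand`**) the REDUCTION: the named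
  fact follows from the forbidden-band estimate "for `d ≥ 3` there are `0 < a < b < #planes` and
  `p₀` such that for `p ≥ p₀` and every `J ≥ 1`, along a subsequence of tori, the Gibbs probability
  that the plaquette energy density `H_L / L^d` lies in `(a, b)` is `≤ θ < 1`" — the statement
  van Enter–Shlosman obtain from reflection positivity, chessboard estimates and the
  Kotecký–Shlosman contour analysis (their eq. (5)–(6) and the universal-contour bounds), which is
  NOT proved here and is NOT introduced as a named fact (D-0026): it is the explicit hypothesis of
  the reduction theorem.

Everything in this file is proved; no definitions of `Prop`-valued facts are introduced.

## References

* A. C. D. van Enter, S. B. Shlosman, Comm. Math. Phys. 255 (2005) 21–32, Thm. 2, eqs. (5)–(6)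
  [VanEnterShlosman2005].
* R. Kotecký, S. B. Shlosman, Comm. Math. Phys. 83 (1982) 493–515 [KoteckyShlosman1982].
* M. Biskup, R. Kotecký, Comm. Math. Phys. 264 (2006) 631–656, Cor. 2 [BiskupKotecky2006].
* E. Seiler, LNP 159 (1982), Ch. 2 (plaquette theories with periodic boundary conditions).
-/

noncomputable section

open _root_.MeasureTheory _root_.ProbabilityTheory _root_.Filter _root_.Set
open scoped Topology

namespace Literature.MathematicalPhysics.QuantumLattice

open Literature.MathematicalPhysics.QuantumFieldTheory
open Literature.MathematicalPhysics.QuantumFieldTheory.UniformTorusAreaLaw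
open Literature.Probability.LatticeModels

namespace NarrowWell

/-! ### The plaquette energy of a weight and the torus pressure as a cumulant generating function -/

section General

variable {d : ℕ} {G : Type*} [Group G]

/-- The number of coordinate planes `{(i, j) : i < j}` of `ℤ^d` (`= d(d-1)/2`), i.e. the number of
plaquettes per site of the torus. [folklore] -/
def planes (d : ℕ) : ℕ := Fintype.card {p : Fin d × Fin d // p.1 < p.2}

/-- For `d ≥ 2` there is at least one plane. [folklore] -/
theorem planes_pos (hd : 2 ≤ d) : 0 < planes d :=
  Fintype.card_pos_iff.2 ⟨⟨(⟨0, by omega⟩, ⟨1, by omega⟩), by simp [Fin.lt_def]⟩⟩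

/-- `#sites = L^d`. [folklore] -/
theorem card_site (d L : ℕ) [NeZero L] : Fintype.card (Site d L) = L ^ d := by
  rw [Fintype.card_fun, ZMod.card, Fintype.card_fin]

/-- `#plaquettes = L^d · #planes`. [folklore] -/
theorem card_plaquette (d L : ℕ) [NeZero L] :
    Fintype.card (Plaquette d L) = L ^ d * planes d := by
  rw [Fintype.card_prod, card_site, planes]

/-- `#edges = L^d · d`. [folklore] -/
theorem card_edge (d L : ℕ) [NeZero L] : Fintype.card (Edge d L) = L ^ d * d := by
  rw [Fintype.card_prod, card_site, Fintype.card_fin]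

/-- The genuine torus labels are in bijection with the plaquettes. [folklore] -/
theorem card_torusGenuine (d L : ℕ) [NeZero L] :
    (torusGenuine d L).card = Fintype.card (Plaquette d L) := by
  rw [← Finset.card_univ]
  symm
  refine Finset.card_bij (fun (P : Plaquette d L) _ => ((P.1, P.2.1.1, P.2.1.2) : TPlaq d L))
    (fun P _ => Finset.mem_filter.2 ⟨Finset.mem_univ _, P.2.2⟩) (fun P _ P' _ h => ?_)
    (fun q hq => ⟨(q.1, ⟨(q.2.1, q.2.2), (Finset.mem_filter.1 hq).2⟩), Finset.mem_univ _, rfl⟩)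
  simp only [Prod.mk.injEq] at h
  obtain ⟨h1, h2, h3⟩ := h
  exact Prod.ext h1 (Subtype.ext (Prod.ext h2 h3))

variable (w : G → ℝ)

/-- The **plaquette energy** `H_L(U) = Σ_q w(U_q)` of the weight `w` on the torus `(ℤ/Lℤ)^d`
(sum over all plaquettes of the weight of the plaquette holonomy). [cite: VanEnterShlosman2005, eq. (3) (the Hamiltonian `-J Σ_P L(U_P)`)] -/
def plaquetteEnergy (L : ℕ) [NeZero L] (U : GaugeConfig d L G) : ℝ :=
  ∑ q : Plaquette d L, w (plaquetteHolonomy U q.1 q.2.1.1 q.2.1.2)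

/-- The Gibbs factor of the fact is `exp (J · H_L)`. [folklore] -/
theorem prod_exp_mul_eq_exp_energy (J : ℝ) (L : ℕ) [NeZero L] (U : GaugeConfig d L G) :
    ∏ q : Plaquette d L, Real.exp (J * w (plaquetteHolonomy U q.1 q.2.1.1 q.2.1.2)) =
      Real.exp (J * plaquetteEnergy w L U) := by
  rw [plaquetteEnergy, Finset.mul_sum, Real.exp_sum]

/-- `0 ≤ H_L` for a non-negative weight. [folklore] -/
theorem plaquetteEnergy_nonneg (hw0 : ∀ g, 0 ≤ w g) (L : ℕ) [NeZero L] (U : GaugeConfig d L G) :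
    0 ≤ plaquetteEnergy w L U :=
  Finset.sum_nonneg fun _ _ => hw0 _

/-- `H_L ≤ #plaquettes` for a weight `≤ 1`. [folklore] -/
theorem plaquetteEnergy_le (hw1 : ∀ g, w g ≤ 1) (L : ℕ) [NeZero L] (U : GaugeConfig d L G) :
    plaquetteEnergy w L U ≤ Fintype.card (Plaquette d L) := by
  unfold plaquetteEnergy
  calc ∑ q : Plaquette d L, w (plaquetteHolonomy U q.1 q.2.1.1 q.2.1.2)
      ≤ ∑ _q : Plaquette d L, (1 : ℝ) := Finset.sum_le_sum fun q _ => hw1 _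
    _ = Fintype.card (Plaquette d L) := by
        rw [Finset.sum_const, Finset.card_univ, nsmul_eq_mul, mul_one]

/-- `|H_L| ≤ #plaquettes` for a weight with values in `[0, 1]`. [folklore] -/
theorem abs_plaquetteEnergy_le (hw0 : ∀ g, 0 ≤ w g) (hw1 : ∀ g, w g ≤ 1) (L : ℕ) [NeZero L]
    (U : GaugeConfig d L G) : |plaquetteEnergy w L U| ≤ Fintype.card (Plaquette d L) := by
  rw [abs_of_nonneg (plaquetteEnergy_nonneg w hw0 L U)]
  exact plaquetteEnergy_le w hw1 L U

variable [TopologicalSpace G] [IsTopologicalGroup G] [MeasurableSpace G] [BorelSpace G]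
  [SecondCountableTopology G]

/-- The plaquette energy of a continuous weight is measurable. [folklore] -/
theorem measurable_plaquetteEnergy (hw : Continuous w) (L : ℕ) [NeZero L] :
    Measurable (plaquetteEnergy (d := d) w L) :=
  Finset.measurable_sum _ fun _ _ => hw.measurable.comp (measurable_plaquetteHolonomy _ _ _)

omit [MeasurableSpace G] [BorelSpace G] [SecondCountableTopology G] in
/-- The plaquette energy of a continuous weight is continuous. [folklore] -/
theorem continuous_plaquetteEnergy (hw : Continuous w) (L : ℕ) [NeZero L] :
    Continuous (plaquetteEnergy (d := d) w L) := by
  unfold plaquetteEnergy plaquetteHolonomy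
  fun_prop

variable [CompactSpace G]

omit [SecondCountableTopology G] in
/-- **The torus pressure of the fact is a normalised cumulant generating function**:
`(L^d)⁻¹ log ∫ ∏_q exp (J w(U_q)) d(⊗ Haar) = (L^d)⁻¹ cgf H_L (⊗ Haar) J`. [folklore] -/
theorem torusPressure_eq (J : ℝ) (L : ℕ) [NeZero L] :
    ((L : ℝ) ^ d)⁻¹ * Real.log (∫ U : GaugeConfig d L G,
        ∏ q : Plaquette d L, Real.exp (J * w (plaquetteHolonomy U q.1 q.2.1.1 q.2.1.2))
        ∂(Measure.pi fun _ : Edge d L => haarProbability G)) =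
      ((L : ℝ) ^ d)⁻¹ * cgf (plaquetteEnergy w L)
        (Measure.pi fun _ : Edge d L => haarProbability G) J := by
  simp_rw [prod_exp_mul_eq_exp_energy]
  rfl

/-! ### The disordered bound: colour–Hölder -/

/-- **Colour–Hölder bound for the torus partition function of a plaquette weight**: for a
continuous non-negative single-plaquette factor `v` on the torus of side `L ≥ 2`, `d ≥ 1`,
`∫ ∏_q v(U_q) d(⊗ Haar) ≤ ((∫_G v^K dg)^{1/K})^{#plaquettes}`, `K = 3^d d²`
(`integral_prod_le_prod_rpow`: Hölder over the colour classes of the torus plaquette hypergraph,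
inside which the holonomies are independent and Haar distributed). [folklore] -/
theorem integral_prod_le_pow {v : G → ℝ} (hv : Continuous v) (hv0 : ∀ g, 0 ≤ v g) (hd : 1 ≤ d)
    {L : ℕ} [NeZero L] (hL : 1 < L) :
    ∫ V : GaugeConfig d L G, ∏ P : Plaquette d L, v (plaquetteHolonomy V P.1 P.2.1.1 P.2.1.2)
        ∂(Measure.pi fun _ : Edge d L => haarProbability G) ≤
      ((∫ g, v g ^ numTColours d ∂haarProbability G) ^ ((numTColours d : ℝ)⁻¹)) ^
        Fintype.card (Plaquette d L) := by
  haveI : Fact (1 < L) := ⟨hL⟩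
  rw [← integral_prod_torusGenuine_eq_integral_pi hv]
  set φ : TPlaq d L → ZdGaugeConfig d G → ℝ :=
    fun q U => v (plaquetteHolonomy (torusSigma L U) q.1 q.2.1 q.2.2) with hφ
  have hφm : ∀ q, Measurable (φ q) := fun q =>
    hv.measurable.comp (measurable_plaquetteHolonomy_torusSigma L q)
  have hφ0 : ∀ q U, 0 ≤ φ q U := fun q U => hv0 _
  have hφb : ∀ q, ∃ C, ∀ U, φ q U ≤ C := by
    intro q
    obtain ⟨C, hC⟩ := isCompact_univ.exists_bound_of_continuousOn hv.continuousOn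
    exact ⟨C, fun U => by
      have := hC _ (Set.mem_univ (plaquetteHolonomy (torusSigma L U) q.1 q.2.1 q.2.2))
      rw [Real.norm_eq_abs] at this
      exact (le_abs_self _).trans this⟩
  have hdep : ∀ q, DependsOn (φ q)
      ((q.tbonds.image (torusSect L) : Finset (ZdEdge d)) : Set (ZdEdge d)) := by
    intro q U V h
    simp only [hφ]
    rw [plaquetteHolonomy_torusSigma_congr L q fun e he =>
      h _ (Finset.mem_coe.2 (Finset.mem_image_of_mem _ he))]
  refine (integral_prod_le_prod_rpow hd (torusGenuine d L) φ hφm hφ0 hφb hdep).trans (le_of_eq ?_)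
  rw [← card_torusGenuine, ← Finset.prod_const]
  refine Finset.prod_congr rfl fun q hq => ?_
  congr 1
  exact integral_comp_plaquetteHolonomy_eq (h := fun g => v g ^ numTColours d) (hv.pow _) q
    (ne_of_lt (mem_torusGenuine.1 hq))

/-- **The disordered bound on the torus pressure**: for a continuous weight `w ≥ 0`, `L ≥ 2`,
`d ≥ 1` and every real `J`,
`cgf H_L (⊗ Haar) J ≤ #plaquettes · K⁻¹ · log ∫_G exp (K J w) dg`, `K = 3^d d²`. [folklore] -/
theorem cgf_plaquetteEnergy_le (hw : Continuous w) (hd : 1 ≤ d) {L : ℕ} [NeZero L] (hL : 1 < L)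
    (J : ℝ) :
    cgf (plaquetteEnergy w L) (Measure.pi fun _ : Edge d L => haarProbability G) J ≤
      Fintype.card (Plaquette d L) * ((numTColours d : ℝ)⁻¹ *
        Real.log (∫ g, Real.exp (numTColours d * J * w g) ∂haarProbability G)) := by
  have hv : Continuous fun g => Real.exp (J * w g) := Real.continuous_exp.comp (continuous_const.mul hw)
  have h := integral_prod_le_pow (d := d) hv (fun g => (Real.exp_pos _).le) hd hL
  simp_rw [prod_exp_mul_eq_exp_energy] at h
  set K := numTColours d with hK
  have hpow : ∀ g, Real.exp (J * w g) ^ K = Real.exp (K * J * w g) := fun g => by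
    rw [← Real.exp_nat_mul]; ring_nf
  simp_rw [hpow] at h
  set M := ∫ g, Real.exp (K * J * w g) ∂haarProbability G with hM
  have hMpos : 0 < M := by
    rw [hM]
    exact integral_exp_pos (Continuous.integrable_of_hasCompactSupport (by fun_prop) (HasCompactSupport.of_compactSpace _))
  rw [cgf, mgf]
  calc Real.log (∫ U, Real.exp (J * plaquetteEnergy w L U) ∂Measure.pi fun _ => haarProbability G)
      ≤ Real.log ((M ^ ((K : ℝ)⁻¹)) ^ Fintype.card (Plaquette d L)) := by
        refine Real.log_le_log (integral_exp_pos ?_) h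
        exact (Real.continuous_exp.comp (continuous_const.mul (continuous_plaquetteEnergy w hw L))
          ).integrable_of_hasCompactSupport (HasCompactSupport.of_compactSpace _)
    _ = Fintype.card (Plaquette d L) * ((K : ℝ)⁻¹ * Real.log M) := by
        rw [Real.log_pow, Real.log_rpow hMpos]

omit [SecondCountableTopology G] in
/-- **The disordered bound, integrated form**: for a continuous weight with values in `[0, 1]`,
`∫_G exp (s w) dg ≤ 1 + (e^s - 1) ∫_G w dg`, hence
`log ∫_G exp (s w) dg ≤ (e^s - 1) ∫_G w dg`. [folklore] -/
theorem log_integral_exp_mul_le (hw : Continuous w) (hw0 : ∀ g, 0 ≤ w g) (hw1 : ∀ g, w g ≤ 1)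
    (s : ℝ) :
    Real.log (∫ g, Real.exp (s * w g) ∂haarProbability G) ≤
      (Real.exp s - 1) * ∫ g, w g ∂haarProbability G := by
  have hint : Integrable w (haarProbability G) :=
    hw.integrable_of_hasCompactSupport (HasCompactSupport.of_compactSpace _)
  have h1 : ∫ g, Real.exp (s * w g) ∂haarProbability G ≤
      1 + (Real.exp s - 1) * ∫ g, w g ∂haarProbability G := by
    calc ∫ g, Real.exp (s * w g) ∂haarProbability G
        ≤ ∫ g, (1 + (Real.exp s - 1) * w g) ∂haarProbability G :=
          integral_mono (Continuous.integrable_of_hasCompactSupport (by fun_prop)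
            (HasCompactSupport.of_compactSpace _))
            ((integrable_const _).add (hint.const_mul _))
            fun g => Literature.Probability.Entropy.exp_mul_le_one_add_expm1_mul s (hw0 g) (hw1 g)
      _ = 1 + (Real.exp s - 1) * ∫ g, w g ∂haarProbability G := by
          rw [integral_add (integrable_const _) (hint.const_mul _), integral_const, integral_const_mul]
          simp
  have hpos : 0 < ∫ g, Real.exp (s * w g) ∂haarProbability G :=
    integral_exp_pos (Continuous.integrable_of_hasCompactSupport (by fun_prop) (HasCompactSupport.of_compactSpace _))
  calc Real.log (∫ g, Real.exp (s * w g) ∂haarProbability G)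
      ≤ ∫ g, Real.exp (s * w g) ∂haarProbability G - 1 := Real.log_le_sub_one_of_pos hpos
    _ ≤ (Real.exp s - 1) * ∫ g, w g ∂haarProbability G := by linarith

/-! ### The ordered bound: restriction to a neighbourhood of the trivial configuration -/

/-- **The ordered bound on the torus partition function**: if every configuration with all bond
variables in the measurable set `B` has all plaquette weights `≥ 1 - c`, then for `J ≥ 0`,
`Haar(B)^{#edges} · exp (J (1 - c) #plaquettes) ≤ ∫ exp (J H_L) d(⊗ Haar)`. [cite: VanEnterShlosman2005, eq. (5)–(6) (the ordered lower bound `Z_L ≥ Z_L^o`, here without gauge fixing)] -/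
theorem mul_exp_le_integral_exp_plaquetteEnergy (hw : Continuous w) {B : Set G}
    (hBm : MeasurableSet B) {c : ℝ} {L : ℕ} [NeZero L]
    (hB : ∀ U : GaugeConfig d L G, (∀ e, U e ∈ B) → ∀ q : Plaquette d L,
      1 - c ≤ w (plaquetteHolonomy U q.1 q.2.1.1 q.2.1.2))
    {J : ℝ} (hJ : 0 ≤ J) :
    (haarProbability G).real B ^ Fintype.card (Edge d L) *
        Real.exp (J * ((1 - c) * Fintype.card (Plaquette d L))) ≤
      ∫ U, Real.exp (J * plaquetteEnergy w L U) ∂(Measure.pi fun _ : Edge d L => haarProbability G) := by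
  set π : Measure (GaugeConfig d L G) := Measure.pi fun _ : Edge d L => haarProbability G with hπ
  set S : Set (GaugeConfig d L G) := Set.pi Set.univ fun _ : Edge d L => B with hS
  have hSm : MeasurableSet S := MeasurableSet.univ_pi fun _ => hBm
  have hπS : π.real S = (haarProbability G).real B ^ Fintype.card (Edge d L) := by
    rw [measureReal_def, hπ, hS, Measure.pi_pi]
    simp [Finset.prod_const, measureReal_def, ENNReal.toReal_pow]
  have hle : ∀ U ∈ S, Real.exp (J * ((1 - c) * Fintype.card (Plaquette d L))) ≤
      Real.exp (J * plaquetteEnergy w L U) := by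
    intro U hU
    refine Real.exp_le_exp.2 (mul_le_mul_of_nonneg_left ?_ hJ)
    have hUe : ∀ e, U e ∈ B := fun e => hU e (Set.mem_univ e)
    calc (1 - c) * Fintype.card (Plaquette d L) = ∑ _q : Plaquette d L, (1 - c) := by
          rw [Finset.sum_const, Finset.card_univ, nsmul_eq_mul, mul_comm]
      _ ≤ plaquetteEnergy w L U := by
          unfold plaquetteEnergy
          exact Finset.sum_le_sum fun q _ => hB U hUe q
  have hint : Integrable (fun U => Real.exp (J * plaquetteEnergy w L U)) π :=
    (Real.continuous_exp.comp (continuous_const.mul (continuous_plaquetteEnergy w hw L))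
      ).integrable_of_hasCompactSupport (HasCompactSupport.of_compactSpace _)
  calc (haarProbability G).real B ^ Fintype.card (Edge d L) *
        Real.exp (J * ((1 - c) * Fintype.card (Plaquette d L)))
      = Real.exp (J * ((1 - c) * Fintype.card (Plaquette d L))) * π.real S := by
        rw [hπS, mul_comm]
    _ ≤ ∫ U in S, Real.exp (J * plaquetteEnergy w L U) ∂π :=
        setIntegral_ge_of_const_le_real hSm (measure_ne_top π S) hle hint.integrableOn
    _ ≤ ∫ U, Real.exp (J * plaquetteEnergy w L U) ∂π :=
        setIntegral_le_integral hint (Eventually.of_forall fun U => (Real.exp_pos _).le)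

end General

/-! ### The narrow well on `SU(2)`: range of the weight, its Haar mean, and the ordered well -/

section SU2

/-- `|Re tr g| ≤ 2` on `SU(2)` (entries of a unitary matrix have norm `≤ 1`). [folklore] -/
theorem abs_trace_re_le_two (g : Matrix.specialUnitaryGroup (Fin 2) ℂ) :
    |((g : Matrix (Fin 2) (Fin 2) ℂ).trace).re| ≤ 2 := by
  have hU : (g : Matrix (Fin 2) (Fin 2) ℂ) ∈ Matrix.unitaryGroup (Fin 2) ℂ :=
    Matrix.specialUnitaryGroup_le_unitaryGroup g.2
  have h0 := entry_norm_bound_of_unitary hU 0 0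
  have h1 := entry_norm_bound_of_unitary hU 1 1
  have h0' := Complex.abs_re_le_norm ((g : Matrix (Fin 2) (Fin 2) ℂ) 0 0)
  have h1' := Complex.abs_re_le_norm ((g : Matrix (Fin 2) (Fin 2) ℂ) 1 1)
  rw [Matrix.trace_fin_two, Complex.add_re]
  calc |((g : Matrix (Fin 2) (Fin 2) ℂ) 0 0).re + ((g : Matrix (Fin 2) (Fin 2) ℂ) 1 1).re|
      ≤ |((g : Matrix (Fin 2) (Fin 2) ℂ) 0 0).re| + |((g : Matrix (Fin 2) (Fin 2) ℂ) 1 1).re| :=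
        abs_add_le _ _
    _ ≤ 2 := by linarith

/-- The one-well density `(1 + Re tr g / 2)/2` lies in `[0, 1]`. [folklore] -/
theorem base_mem_unitInterval (g : Matrix.specialUnitaryGroup (Fin 2) ℂ) :
    0 ≤ (1 + ((g : Matrix (Fin 2) (Fin 2) ℂ).trace).re / 2) / 2 ∧
      (1 + ((g : Matrix (Fin 2) (Fin 2) ℂ).trace).re / 2) / 2 ≤ 1 := by
  have h := abs_le.1 (abs_trace_re_le_two g)
  constructor
  · linarith [h.1]
  · linarith [h.2]

/-- `0 ≤ weight p`. [folklore] -/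
theorem weight_nonneg (p : ℕ) (g : Matrix.specialUnitaryGroup (Fin 2) ℂ) : 0 ≤ weight p g :=
  pow_nonneg (base_mem_unitInterval g).1 p

/-- `weight p ≤ 1`. [folklore] -/
theorem weight_le_one (p : ℕ) (g : Matrix.specialUnitaryGroup (Fin 2) ℂ) : weight p g ≤ 1 :=
  pow_le_one₀ (base_mem_unitInterval g).1 (base_mem_unitInterval g).2

/-- `weight p 1 = 1`: the well is centred at the identity. [folklore] -/
theorem weight_one (p : ℕ) : weight p (1 : Matrix.specialUnitaryGroup (Fin 2) ℂ) = 1 := by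
  have h : (((1 : Matrix.specialUnitaryGroup (Fin 2) ℂ) : Matrix (Fin 2) (Fin 2) ℂ).trace).re = 2 := by
    rw [OneMemClass.coe_one, Matrix.trace_one]
    simp
  rw [weight, h]
  norm_num

/-- If `f ≤ 𝟙_S + C` pointwise then `∫ f dμ ≤ μ(S) + C` for a probability measure `μ`. [folklore] -/
theorem integral_le_measureReal_add {X : Type*} [MeasurableSpace X] (μ : Measure X)
    [IsProbabilityMeasure μ] {S : Set X} (hS : MeasurableSet S) {f : X → ℝ} (hf : Integrable f μ)
    {C : ℝ} (hpt : ∀ x, f x ≤ S.indicator 1 x + C) : ∫ x, f x ∂μ ≤ μ.real S + C := by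
  have hind : Integrable (S.indicator (1 : X → ℝ)) μ := (integrable_const (1 : ℝ)).indicator hS
  have hc : Integrable (fun _ : X => C) μ := integrable_const C
  have hF : Integrable (fun x => S.indicator (1 : X → ℝ) x + C) μ := hind.add hc
  calc ∫ x, f x ∂μ ≤ ∫ x, (S.indicator (1 : X → ℝ) x + C) ∂μ := integral_mono hf hF hpt
    _ = μ.real S + C := by
        rw [integral_add hind hc, integral_indicator_one hS, integral_const, probReal_univ, one_smul]

/-- **The Haar mean of the narrow well is small**: for `0 < r ≤ 2`,
`∫ weight p dHaar ≤ 4 r³ + (1 - r²/4)^p` — split `SU(2)` into the trace-ball `{2 - Re tr < r²}`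
(Haar measure `≤ 4 r³`, `haarProbability_su2_two_sub_trace_lt_le`) where `weight ≤ 1`, and its
complement where the base `(1 + Re tr/2)/2 = 1 - (2 - Re tr)/4 ≤ 1 - r²/4` (the chord bound for
`exp` is `Literature.Probability.Entropy.exp_mul_le_one_add_expm1_mul`). [folklore] -/
theorem integral_weight_le (p : ℕ) {r : ℝ} (hr : 0 < r) (hr2 : r ≤ 2) :
    ∫ g, weight p g ∂haarProbability (Matrix.specialUnitaryGroup (Fin 2) ℂ) ≤
      4 * r ^ 3 + (1 - r ^ 2 / 4) ^ p := by
  have hTm : MeasurableSet {U : Matrix.specialUnitaryGroup (Fin 2) ℂ |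
      2 - ((U : Matrix (Fin 2) (Fin 2) ℂ).trace).re < r ^ 2} := by
    refine (isOpen_lt ?_ continuous_const).measurableSet
    exact continuous_const.sub (Complex.continuous_re.comp (continuous_subtype_val.matrix_trace))
  have hq0 : 0 ≤ 1 - r ^ 2 / 4 := by nlinarith
  have hpt : ∀ g : Matrix.specialUnitaryGroup (Fin 2) ℂ, weight p g ≤
      Set.indicator {U : Matrix.specialUnitaryGroup (Fin 2) ℂ |
        2 - ((U : Matrix (Fin 2) (Fin 2) ℂ).trace).re < r ^ 2}
        (1 : Matrix.specialUnitaryGroup (Fin 2) ℂ → ℝ) g + (1 - r ^ 2 / 4) ^ p := by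
    intro g
    by_cases hg : 2 - ((g : Matrix (Fin 2) (Fin 2) ℂ).trace).re < r ^ 2
    · rw [Set.indicator_of_mem (by exact hg), Pi.one_apply]
      linarith [weight_le_one p g, pow_nonneg hq0 p]
    · rw [Set.indicator_of_notMem (by exact hg), zero_add]
      refine pow_le_pow_left₀ (base_mem_unitInterval g).1 ?_ p
      simp only [not_lt] at hg
      linarith
  have hint : Integrable (weight p) (haarProbability (Matrix.specialUnitaryGroup (Fin 2) ℂ)) :=
    (continuous_weight p).integrable_of_hasCompactSupport (HasCompactSupport.of_compactSpace _)
  have hmeas : (haarProbability (Matrix.specialUnitaryGroup (Fin 2) ℂ)).real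
      {U : Matrix.specialUnitaryGroup (Fin 2) ℂ |
        2 - ((U : Matrix (Fin 2) (Fin 2) ℂ).trace).re < r ^ 2} ≤ 4 * r ^ 3 := by
    rw [measureReal_def]
    exact ENNReal.toReal_le_of_le_ofReal (by positivity) (haarProbability_su2_two_sub_trace_lt_le hr)
  have h := integral_le_measureReal_add (haarProbability (Matrix.specialUnitaryGroup (Fin 2) ℂ))
    hTm hint hpt
  linarith

/-- **The Haar mean of the narrow well tends to `0`** as the non-linearity `p → ∞`
(the well `{weight p ≈ 1}` has width `O(p^{-1/2})`). [folklore] -/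
theorem tendsto_integral_weight :
    Tendsto (fun p : ℕ => ∫ g, weight p g ∂haarProbability (Matrix.specialUnitaryGroup (Fin 2) ℂ))
      atTop (𝓝 0) := by
  refine Metric.tendsto_atTop.2 fun ε hε => ?_
  set r : ℝ := min 1 (ε / 16) with hr
  have hr0 : 0 < r := lt_min one_pos (by linarith)
  have hr1 : r ≤ 1 := min_le_left _ _
  have hrε : r ≤ ε / 16 := min_le_right _ _
  have hr2 : r ^ 2 ≤ 1 := by nlinarith
  have hr3' : r ^ 3 ≤ r := by nlinarith
  have hr3 : 4 * r ^ 3 ≤ ε / 4 := by linarith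
  have hq0 : 0 ≤ 1 - r ^ 2 / 4 := by nlinarith
  have hq1 : 1 - r ^ 2 / 4 < 1 := by nlinarith
  have hpow := tendsto_pow_atTop_nhds_zero_of_lt_one hq0 hq1
  obtain ⟨N, hN⟩ := Metric.tendsto_atTop.1 hpow (ε / 2) (by linarith)
  refine ⟨N, fun p hp => ?_⟩
  have h1 := hN p hp
  rw [Real.dist_eq, sub_zero, abs_of_nonneg (pow_nonneg hq0 p)] at h1
  have h2 := integral_weight_le p hr0 (by linarith)
  have h3 : 0 ≤ ∫ g, weight p g ∂haarProbability (Matrix.specialUnitaryGroup (Fin 2) ℂ) :=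
    integral_nonneg fun g => weight_nonneg p g
  rw [Real.dist_eq, sub_zero, abs_of_nonneg h3]
  linarith

/-- **The ordered well**: for every `p` and `c > 0` there is an open neighbourhood `B` of the
identity in `SU(2)` such that any four bond variables in `B` give a plaquette weight
`weight p (g₁ g₂ g₃⁻¹ g₄⁻¹) ≥ 1 - c` (continuity at the trivial configuration, `weight p 1 = 1`).
[cite: VanEnterShlosman2005, eq. (5)–(6) (the arcs `I_b` of length `ε/4`)] -/
theorem exists_isOpen_weight_ge (p : ℕ) {c : ℝ} (hc : 0 < c) :
    ∃ B : Set (Matrix.specialUnitaryGroup (Fin 2) ℂ), IsOpen B ∧ 1 ∈ B ∧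
      ∀ g : Fin 4 → Matrix.specialUnitaryGroup (Fin 2) ℂ, (∀ i, g i ∈ B) →
        1 - c ≤ weight p (g 0 * g 1 * (g 2)⁻¹ * (g 3)⁻¹) := by
  set F : (Fin 4 → Matrix.specialUnitaryGroup (Fin 2) ℂ) → ℝ :=
    fun g => weight p (g 0 * g 1 * (g 2)⁻¹ * (g 3)⁻¹) with hF
  have hFc : Continuous F := (continuous_weight p).comp (by fun_prop)
  have hF1 : F (fun _ => 1) = 1 := by simp [hF, weight_one]
  have hpre : F ⁻¹' Set.Ioi (1 - c) ∈ 𝓝 (fun _ : Fin 4 => (1 : Matrix.specialUnitaryGroup (Fin 2) ℂ)) :=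
    hFc.continuousAt.preimage_mem_nhds (Ioi_mem_nhds (by rw [hF1]; linarith))
  rw [nhds_pi, Filter.mem_pi] at hpre
  obtain ⟨I, -, t, ht, hts⟩ := hpre
  set B₀ : Set (Matrix.specialUnitaryGroup (Fin 2) ℂ) := ⋂ i, t i with hB₀
  have hB₀ : B₀ ∈ 𝓝 (1 : Matrix.specialUnitaryGroup (Fin 2) ℂ) :=
    (Filter.iInter_mem).2 ht
  obtain ⟨B, hBB₀, hBo, h1B⟩ := mem_nhds_iff.1 hB₀
  refine ⟨B, hBo, h1B, fun g hg => ?_⟩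
  have hgs : g ∈ F ⁻¹' Set.Ioi (1 - c) :=
    hts fun i _ => Set.mem_iInter.1 (hBB₀ (hg i)) i
  exact le_of_lt hgs

end SU2

/-! ### The reduction of the named fact to the forbidden-band estimate -/

section Reduction

variable {d : ℕ}

/-- **Lower bound on the finite-volume pressure from the ordered well**: if all bond variables in
the measurable set `B` force all plaquette weights `≥ 1 - c`, then for `J ≥ 0` and every torus,
`d · log Haar(B) + J (1 - c) #planes ≤ (L^d)⁻¹ cgf H_L (⊗ Haar) J`. [cite: VanEnterShlosman2005, eq. (6)] -/
theorem le_torusPressure (p : ℕ) {B : Set (Matrix.specialUnitaryGroup (Fin 2) ℂ)}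
    (hBm : MeasurableSet B) (hBpos : 0 < (haarProbability (Matrix.specialUnitaryGroup (Fin 2) ℂ)).real B)
    {c : ℝ} (hB : ∀ g : Fin 4 → Matrix.specialUnitaryGroup (Fin 2) ℂ, (∀ i, g i ∈ B) →
      1 - c ≤ weight p (g 0 * g 1 * (g 2)⁻¹ * (g 3)⁻¹))
    {J : ℝ} (hJ : 0 ≤ J) (L : ℕ) [NeZero L] :
    (d : ℝ) * Real.log ((haarProbability (Matrix.specialUnitaryGroup (Fin 2) ℂ)).real B) +
        J * ((1 - c) * planes d) ≤
      ((L : ℝ) ^ d)⁻¹ * cgf (plaquetteEnergy (d := d) (weight p) L)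
        (Measure.pi fun _ : Edge d L => haarProbability (Matrix.specialUnitaryGroup (Fin 2) ℂ)) J := by
  haveI : SecondCountableTopology (Matrix.specialUnitaryGroup (Fin 2) ℂ) :=
    secondCountableTopology_su2
  set β := (haarProbability (Matrix.specialUnitaryGroup (Fin 2) ℂ)).real B with hβ
  have hB' : ∀ U : GaugeConfig d L (Matrix.specialUnitaryGroup (Fin 2) ℂ), (∀ e, U e ∈ B) →
      ∀ q : Plaquette d L, 1 - c ≤ weight p (plaquetteHolonomy U q.1 q.2.1.1 q.2.1.2) := by
    intro U hU q
    have h := hB ![U (q.1, q.2.1.1), U (q.1.shift q.2.1.1, q.2.1.2), U (q.1.shift q.2.1.2, q.2.1.1),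
      U (q.1, q.2.1.2)] (fun i => by fin_cases i <;> exact hU _)
    simpa [plaquetteHolonomy] using h
  have hlow := mul_exp_le_integral_exp_plaquetteEnergy (d := d) (weight p) (continuous_weight p) hBm
    hB' hJ (L := L)
  have hLpos : (0 : ℝ) < (L : ℝ) ^ d := pow_pos (Nat.cast_pos.2 (Nat.pos_of_ne_zero (NeZero.ne L))) d
  have hlhs_pos : 0 < β ^ Fintype.card (Edge d L) *
      Real.exp (J * ((1 - c) * Fintype.card (Plaquette d L))) := by positivity
  rw [cgf, mgf]
  have hlog := Real.log_le_log hlhs_pos hlow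
  rw [Real.log_mul (pow_pos hBpos _).ne' (Real.exp_pos _).ne', Real.log_pow, Real.log_exp,
    card_edge, card_plaquette] at hlog
  rw [le_inv_mul_iff₀ hLpos]
  push_cast at hlog ⊢
  nlinarith [hlog]

/-- **Upper bound on the finite-volume pressure from the disordered bound**: for every real `J`,
`d ≥ 1` and torus side `L ≥ 2`,
`(L^d)⁻¹ cgf H_L (⊗ Haar) J ≤ #planes · K⁻¹ · (e^{K J} - 1) ∫ weight p dHaar`, `K = 3^d d²`.
[folklore] -/
theorem torusPressure_le (hd : 1 ≤ d) (p : ℕ) (J : ℝ) {L : ℕ} [NeZero L] (hL : 1 < L) :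
    ((L : ℝ) ^ d)⁻¹ * cgf (plaquetteEnergy (d := d) (weight p) L)
        (Measure.pi fun _ : Edge d L => haarProbability (Matrix.specialUnitaryGroup (Fin 2) ℂ)) J ≤
      planes d * ((numTColours d : ℝ)⁻¹ * ((Real.exp (numTColours d * J) - 1) *
        ∫ g, weight p g ∂haarProbability (Matrix.specialUnitaryGroup (Fin 2) ℂ))) := by
  haveI : SecondCountableTopology (Matrix.specialUnitaryGroup (Fin 2) ℂ) :=
    secondCountableTopology_su2
  have h1 := cgf_plaquetteEnergy_le (d := d) (weight p) (continuous_weight p) hd hL J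
  have h2 := log_integral_exp_mul_le (G := Matrix.specialUnitaryGroup (Fin 2) ℂ) (weight p)
    (continuous_weight p) (weight_nonneg p) (weight_le_one p) (numTColours d * J)
  have hLpos : (0 : ℝ) < (L : ℝ) ^ d := pow_pos (Nat.cast_pos.2 (Nat.pos_of_ne_zero (NeZero.ne L))) d
  have hKinv : (0 : ℝ) ≤ (numTColours d : ℝ)⁻¹ := by positivity
  rw [inv_mul_le_iff₀ hLpos, card_plaquette] at *
  have h3 : ((L ^ d * planes d : ℕ) : ℝ) * ((numTColours d : ℝ)⁻¹ *
      Real.log (∫ g, Real.exp (numTColours d * J * weight p g)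
        ∂haarProbability (Matrix.specialUnitaryGroup (Fin 2) ℂ))) ≤
      ((L ^ d * planes d : ℕ) : ℝ) * ((numTColours d : ℝ)⁻¹ * ((Real.exp (numTColours d * J) - 1) *
        ∫ g, weight p g ∂haarProbability (Matrix.specialUnitaryGroup (Fin 2) ℂ))) :=
    mul_le_mul_of_nonneg_left (mul_le_mul_of_nonneg_left h2 hKinv) (by positivity)
  refine (h1.trans h3).trans (le_of_eq ?_)
  push_cast
  ring

/-- **Reduction of van Enter–Shlosman's Theorem 2 (`SU(2)` instance) to the forbidden-band
estimate.** Suppose that for every `d ≥ 3` there are `0 < a < b < #planes` and `p₀` such that for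
all `p ≥ p₀` and all couplings `J ≥ 1`, along a subsequence of the tori `(ℤ/(L+1)ℤ)^d`, the
finite-volume Gibbs measure `exp (J Σ_q weight p (U_q)) d(⊗ Haar) / Z` gives the band
`{a < Σ_q weight p (U_q) / (L+1)^d < b}` of plaquette-energy densities probability `≤ θ < 1`
(the contour estimate of van Enter–Shlosman / Kotecký–Shlosman: with overwhelming probability the
torus is either mostly ordered or mostly disordered, uniformly in the temperature). Then the named
fact `enterShlosman_narrowWell_firstOrderTransition` holds: by the disordered bound the pressure
has slope `≤ a` near `J = 1` for `p` large (`∫ weight p dHaar → 0`), by the ordered well its secant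
slope from `0` to a large `J₂` is `≥ b`, and the forbidden-band criterion
`ForbiddenGap.exists_not_differentiableAt_of_forbidden_band` yields a coupling in `[1, J₂]` where
the pressure is not differentiable. [cite: VanEnterShlosman2005, Thm. 2 and its proof sketch (eqs. (5)–(6), universal contours)] -/
theorem enterShlosman_narrowWell_firstOrderTransition_of_forbiddenBand
    (hband : ∀ d : ℕ, 3 ≤ d → ∃ a b : ℝ, 0 < a ∧ a < b ∧ b < (planes d : ℝ) ∧ ∃ p₀ : ℕ, ∀ p : ℕ,
      p₀ ≤ p → ∀ J : ℝ, 1 ≤ J → ∃ θ : ℝ, θ < 1 ∧ ∃ᶠ L : ℕ in atTop,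
        ((Measure.pi fun _ : Edge d (L + 1) =>
            haarProbability (Matrix.specialUnitaryGroup (Fin 2) ℂ)).tilted
          (fun U => J * plaquetteEnergy (weight p) (L + 1) U)).real
          {U | plaquetteEnergy (weight p) (L + 1) U / (((L + 1 : ℕ) : ℝ) ^ d) ∈ Set.Ioo a b} ≤ θ) :
    enterShlosman_narrowWell_firstOrderTransition := by
  haveI : SecondCountableTopology (Matrix.specialUnitaryGroup (Fin 2) ℂ) :=
    secondCountableTopology_su2
  intro d hd
  obtain ⟨a, b, ha, hab, hbm, p₀, hp₀⟩ := hband d hd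
  have hd1 : 1 ≤ d := by omega
  set G := Matrix.specialUnitaryGroup (Fin 2) ℂ with hG
  set m : ℝ := (planes d : ℝ) with hm
  set K : ℝ := (numTColours d : ℝ) with hK
  have hmpos : 0 < m := by rw [hm]; exact_mod_cast planes_pos (by omega)
  have hKpos : 0 < K := by rw [hK]; exact_mod_cast numTColours_pos hd1
  -- `p₁`: the disordered bound at `J = 2` is below `a`
  have hsmall : ∀ᶠ p : ℕ in atTop,
      m * (K⁻¹ * ((Real.exp (K * 2) - 1) * ∫ g, weight p g ∂haarProbability G)) < a := by
    have h := (tendsto_integral_weight.const_mul (Real.exp (K * 2) - 1)).const_mul K⁻¹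
      |>.const_mul m
    simp only [mul_zero] at h
    exact h.eventually (gt_mem_nhds ha)
  obtain ⟨p₁, hp₁⟩ := eventually_atTop.1 hsmall
  refine ⟨max p₀ p₁, fun p hp P hP => ?_⟩
  have hpp₀ : p₀ ≤ p := le_of_max_le_left hp
  have hpp₁ : p₁ ≤ p := le_of_max_le_right hp
  -- the data of the abstract criterion
  set μ : ∀ L : ℕ, Measure (GaugeConfig d (L + 1) G) :=
    fun L => Measure.pi fun _ : Edge d (L + 1) => haarProbability G with hμ
  set H : ∀ L : ℕ, GaugeConfig d (L + 1) G → ℝ := fun L => plaquetteEnergy (weight p) (L + 1)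
    with hH
  set V : ℕ → ℝ := fun L => ((L + 1 : ℕ) : ℝ) ^ d with hV
  have hHm : ∀ L, Measurable (H L) := fun L =>
    measurable_plaquetteEnergy (weight p) (continuous_weight p) (L + 1)
  have hHb : ∀ L, ∃ C, ∀ U, |H L U| ≤ C := fun L =>
    ⟨_, fun U => abs_plaquetteEnergy_le (weight p) (weight_nonneg p) (weight_le_one p) (L + 1) U⟩
  have hV0 : ∀ L, 0 < V L := fun L => by positivity
  have hVtop : Tendsto V atTop atTop := by
    refine (tendsto_pow_atTop (by omega : d ≠ 0)).comp ?_
    exact tendsto_natCast_atTop_atTop.comp (tendsto_add_atTop_nat 1)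
  have hPJ : ∀ J, Tendsto (fun L => (V L)⁻¹ * cgf (H L) (μ L) J) atTop (𝓝 (P J)) := by
    intro J
    have h := hP J
    simp_rw [torusPressure_eq] at h
    exact h
  -- `P 0 = 0` and `0 ≤ P 1`
  have hP0 : P 0 = 0 := by
    refine tendsto_nhds_unique (hPJ 0) ?_
    simp_rw [cgf_zero, mul_zero]
    exact tendsto_const_nhds
  have hP1 : 0 ≤ P 1 := by
    refine ge_of_tendsto' (hPJ 1) fun L => mul_nonneg (inv_nonneg.2 (hV0 L).le) ?_
    rw [cgf, mgf]
    refine Real.log_nonneg ?_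
    have hint : Integrable (fun U => Real.exp (1 * H L U)) (μ L) :=
      ForbiddenGap.integrable_exp_mul_of_abs_le (hHm L) (hHb L).choose_spec 1
    calc (1 : ℝ) = ∫ _U, (1 : ℝ) ∂μ L := by simp
      _ ≤ ∫ U, Real.exp (1 * H L U) ∂μ L := integral_mono (integrable_const _) hint fun U => by
          rw [one_mul]
          exact Real.one_le_exp (plaquetteEnergy_nonneg (weight p) (weight_nonneg p) _ U)
  -- the disordered bound at `J = 2`
  have hP2 : P 2 ≤ a := by
    refine le_of_tendsto (hPJ 2) ?_
    filter_upwards [eventually_ge_atTop 1] with L hL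
    have h := torusPressure_le hd1 p 2 (L := L + 1) (by omega)
    rw [← hm, ← hK] at h
    have h' := hp₁ p hpp₁
    exact h.trans h'.le
  -- the ordered well
  set c : ℝ := (m - b) / (2 * m) with hc
  have hcpos : 0 < c := by rw [hc]; exact div_pos (by linarith) (by linarith)
  obtain ⟨B, hBo, h1B, hBw⟩ := exists_isOpen_weight_ge p hcpos
  set β : ℝ := (haarProbability G).real B with hβ
  have hβpos : 0 < β := by
    rw [hβ, measureReal_def]
    refine ENNReal.toReal_pos ?_ (measure_ne_top _ _)
    rw [show haarProbability G = Measure.haarMeasure ⊤ from rfl]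
    exact (hBo.measure_pos _ ⟨1, h1B⟩).ne'
  have hβ1 : β ≤ 1 := by rw [hβ]; exact measureReal_le_one
  have hlogβ : Real.log β ≤ 0 := Real.log_nonpos hβpos.le hβ1
  -- the large coupling `J₂`
  set J₂ : ℝ := max 1 (-(2 * d * Real.log β) / (m - b)) with hJ₂
  have hJ₂1 : 1 ≤ J₂ := le_max_left _ _
  have hJ₂' : -(2 * d * Real.log β) / (m - b) ≤ J₂ := le_max_right _ _
  have hPJ₂ : b * (J₂ - 0) ≤ P J₂ - P 0 := by
    rw [sub_zero, hP0, sub_zero]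
    have hlow : (d : ℝ) * Real.log β + J₂ * ((1 - c) * m) ≤ P J₂ :=
      ge_of_tendsto' (hPJ J₂) fun L =>
        le_torusPressure p hBo.measurableSet hβpos hBw (by linarith) (L + 1)
    have hmb : 0 < m - b := by linarith
    have hkey : -(2 * d * Real.log β) ≤ J₂ * (m - b) := (div_le_iff₀ hmb).1 hJ₂'
    have hcm : (1 - c) * m = (m + b) / 2 := by
      rw [hc]; field_simp; ring
    rw [hcm] at hlow
    nlinarith [hlow, hkey]
  -- the criterion on `[1, J₂]`
  have hband' : ∀ J ∈ Set.Icc 1 J₂, ∃ θ : ℝ, θ < 1 ∧ ∃ᶠ L in atTop,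
      ((μ L).tilted fun U => J * H L U).real {U | H L U / V L ∈ Set.Ioo a b} ≤ θ :=
    fun J hJ => hp₀ p hpp₀ J hJ.1
  obtain ⟨J, hJ, hJdiff⟩ := ForbiddenGap.exists_not_differentiableAt_of_forbidden_band hHm hHb
    hVtop hV0 hPJ hJ₂1 hab ⟨2, by norm_num, by linarith⟩ ⟨0, by linarith, hPJ₂⟩ hband'
  exact ⟨J, by linarith [hJ.1], hJdiff⟩

end Reduction

end NarrowWell

end Literature.MathematicalPhysics.QuantumLattice

end
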